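import Mathlib
import HarnessLib
import Summits.HubbardSuperconductivity.HubbardSuperconductivity.Theses.LiebTwin
import Literature.MathematicalPhysics.QuantumLattice.HubbardLiebBasis
import Literature.MathematicalPhysics.QuantumLattice.XYOrderGDProofs

/-!
# Gaussian domination for the Hubbard model in Lieb's coordinates (Kubo–Kishi at `T = 0`), I:
# the matrix inequality

Helper file (`--supports stmt-HubbardSuperconductivity-0933`, crux `NoOnsiteODLRO` shared by the routes
`LiebTwin` / `EnslavedA1g`; route-prover LiebTwin-0, session 5). The crux — no on-site `s`-wave pair
condensation in any doped repulsive ground state — is research-open off half filling (crux census T1: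
"the positivity that makes the sibling work is absent"). This file and its sequel
(`LiebTwinNoOnsiteODLROHalfFillingGaussianDomination`) prove the SIBLING's engine, **Gaussian domination
in spin space for ground states of the half-filled repulsive Hubbard model**, i.e. Kubo–Kishi's bound
`χ_charge ≤ 1/U` (PRB 41 (1990) 4866, Thm 1) at zero temperature, obtained directly at `T = 0` from
Kennedy–Lieb–Shastry's ground-state reflection positivity (`Matrix.exists_kls_tracePair`, tree file
`XYOrderGDProofs`) in Lieb's hole–particle coordinates (`LiebTwo.toFock`,
`LiebTwo.hamiltonian_mulVec_toFock`, tree file `HubbardLiebBasis`).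

## Contents (matrix level, any bipartite colouring `A`, any `t`, every `U > 0`)

Write a Fock vector as `ψ = Φ(M)` (`Φ = LiebTwo.toFock A`, the down species hole-transformed). Then
`⟨Φ M, H Φ M⟩ = tr(MᴴKM) + tr(MᴴMK) + U Σ_x (tr(Mᴴn_xM) - tr(Mᴴn_xMn_x))` (`expect_hamiltonian_toFock`,
`hsInner_liebOperator`); the occupations act on rows / columns (`numberOp_up_mulVec_toFock`,
`numberOp_down_mulVec_toFock`), the charge deviation as a commutator,
`(n_{x↑} + n_{x↓} - 1) Φ(M) = Φ(n_x M - M n_x)` (`chargeDev_mulVec_toFock`), so that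
`⟨Φ M, Σ_x h_x (n_x - 1) Φ M⟩ = Σ_x h_x (tr(Mᴴn_xM) - tr(MᴴMn_x))` (`expect_chargeField_toFock`).
For the KLS trace pair `(c_L, c_R)` of `M` (`c_L² = MMᴴ`, `c_R² = MᴴM`, positive semidefinite) the pair
inequality tested against the shifted occupations `n_x ∓ h_x/(2U)` — the field drops out of the
reflected terms (`kls_shifted_occupation`) — gives (`gaussianDomination_raw`, `gaussianDomination_energy`)

  `Σ_x h_x (tr(Mᴴn_xM) - tr(MᴴMn_x)) ≤ E(M) - ½(E(c_L) + E(c_R)) - (U/2)·Σ_x(tr(Mᴴn_xM) - tr(MᴴMn_x))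
     + (Σ_x h_x²/(2U))·tr(MᴴM)`,   `E(X) = Re ⟨X, 𝓛 X⟩_HS = ⟨Φ X, H Φ X⟩`.

On the torus this is the registered stub `stub_halfFillingGDLiebCoordinates`. The sequel turns it into
the sector statement `Re⟨ψ, Σ_x h_x(n_x - 1)ψ⟩ ≤ Re⟨ψ,Hψ⟩ - E₀‖ψ‖² + (Σ_x h_x²/(2U))‖ψ‖²` at half filling.

References: K. Kubo, T. Kishi, Phys. Rev. B 41 (1990) 4866, Thm 1, eqs. (7)–(10) [KuboKishi1990];
T. Kennedy, E. H. Lieb, B. S. Shastry, J. Stat. Phys. 53 (1988) 1019, eqs. (20)–(25) [KLS1988JSP];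
F. J. Dyson, E. H. Lieb, B. Simon, J. Stat. Phys. 18 (1978) 335, Lemma 4.1 / Thm 4.2 [DLS1978];
E. H. Lieb, Phys. Rev. Lett. 62 (1989) 1201, proof of Thm 2 [LiebPRL1989]. Everything is proved
(standard axioms); no definition and no named fact is introduced.
-/

-- the mandated namespace `Summit.<Summit>.<Problem>.Theorems` repeats `HubbardSuperconductivity`

set_option linter.dupNamespace false

noncomputable section

namespace Summit.HubbardSuperconductivity.HubbardSuperconductivity.Theorems.NoOnsiteODLRO.HalfFilling

open Matrix Finset
open Literature.Probability.LatticeModels Literature.MathematicalPhysics.QuantumLattice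
open Literature.MathematicalPhysics.QuantumLattice.LiebTwo
open scoped ComplexOrder

section Actions

variable {Λ : Type*} [LinearOrder Λ] [Fintype Λ]

/-- `n_{x↑} Φ(M) = Φ(n_x M)`: in Lieb's hole–particle coordinates the up occupation acts on the row
index. Lieb, PRL 62 (1989) 1201, proof of Theorem 2. [folklore] -/
theorem numberOp_up_mulVec_toFock (A : Finset Λ) (x : Λ) (M : Matrix (Finset Λ) (Finset Λ) ℂ) :
    numberOp x 0 *ᵥ toFock A M = toFock A (numberAt x * M) := by
  funext s
  rw [numberOp_mulVec, numberAt_eq_diagonal]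
  simp only [toFock, diagonal_mul]
  by_cases hx : orb x 0 ∈ s
  · have hx' : x ∈ upPart s := (mem_upPart s x).2 hx
    simp [hx, hx']
  · have hx' : x ∉ upPart s := fun h => hx ((mem_upPart s x).1 h)
    simp [hx, hx']

/-- `n_{x↓} Φ(M) = Φ(M - M n_x)`: the down occupation is one minus the hole occupation, acting on
the column index. Lieb, PRL 62 (1989) 1201, proof of Theorem 2. [folklore] -/
theorem numberOp_down_mulVec_toFock (A : Finset Λ) (x : Λ) (M : Matrix (Finset Λ) (Finset Λ) ℂ) :
    numberOp x 1 *ᵥ toFock A M = toFock A (M - M * numberAt x) := by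
  funext s
  rw [numberOp_mulVec, numberAt_eq_diagonal]
  simp only [toFock, mul_diagonal, Matrix.sub_apply]
  by_cases hx : orb x 1 ∈ s
  · simp [hx]
  · simp [hx]


/-- The charge deviation `n_{x↑} + n_{x↓} - 1` acts as the commutator with the row/column
occupation: `(n_{x↑} + n_{x↓} - 1) Φ(M) = Φ(n_x M - M n_x)`. Kubo–Kishi, PRB 41 (1990) 4866,
proof of Thm 1 (the charge operator after the partial particle–hole map). [folklore] -/
theorem chargeDev_mulVec_toFock (A : Finset Λ) (x : Λ) (M : Matrix (Finset Λ) (Finset Λ) ℂ) :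
    (numberOp x 0 + numberOp x 1 - 1) *ᵥ toFock A M = toFock A (numberAt x * M - M * numberAt x) := by
  rw [sub_mulVec, add_mulVec, one_mulVec, numberOp_up_mulVec_toFock, numberOp_down_mulVec_toFock,
    ← toFock_add, ← toFock_sub]
  congr 1
  abel

/-- `Φ` commutes with finite sums. [folklore] -/
theorem toFock_sum {κ : Type*} (A : Finset Λ) (S : Finset κ) (M : κ → Matrix (Finset Λ) (Finset Λ) ℂ) :
    toFock A (∑ k ∈ S, M k) = ∑ k ∈ S, toFock A (M k) := by
  classical
  induction S using Finset.induction_on with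
  | empty =>
      rw [Finset.sum_empty, Finset.sum_empty]
      funext s
      simp [toFock]
  | insert a S ha ih => rw [Finset.sum_insert ha, Finset.sum_insert ha, toFock_add, ih]

/-- The charge field `M_h = Σ_x h_x (n_{x↑} + n_{x↓} - 1)` in Lieb's coordinates:
`M_h Φ(M) = Φ(Σ_x h_x (n_x M - M n_x))`. [folklore] -/
theorem chargeField_mulVec_toFock (A : Finset Λ) (h : Λ → ℝ) (M : Matrix (Finset Λ) (Finset Λ) ℂ) :
    (∑ x : Λ, ((h x : ℝ) : ℂ) • (numberOp x 0 + numberOp x 1 - 1)) *ᵥ toFock A M =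
      toFock A (∑ x : Λ, ((h x : ℝ) : ℂ) • (numberAt x * M - M * numberAt x)) := by
  rw [Matrix.sum_mulVec, toFock_sum]
  refine Finset.sum_congr rfl fun x _ => ?_
  rw [smul_mulVec, chargeDev_mulVec_toFock, toFock_smul]


end Actions

section Expectations

variable {Λ : Type*} [LinearOrder Λ] [Fintype Λ] (G : SimpleGraph Λ) [DecidableRel G.Adj]

/-- `⟨Z, Σ_k W_k⟩ = Σ_k ⟨Z, W_k⟩`. [folklore] -/
theorem hsInner_sum_right {A κ : Type*} [Fintype A] (Z : Matrix A A ℂ) (S : Finset κ)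
    (W : κ → Matrix A A ℂ) : hsInner Z (∑ k ∈ S, W k) = ∑ k ∈ S, hsInner Z (W k) := by
  simp only [hsInner, Matrix.mul_sum, trace_sum]

/-- **Energy in Lieb's coordinates.** For a bipartite colouring `A`,
`⟨Φ(M), H Φ(M)⟩ = ⟨M, 𝓛 M⟩_HS`. Lieb, PRL 62 (1989) 1201, eqs. (3)–(5). [cite: LiebPRL1989, eqs. (3)–(5)] -/
theorem expect_hamiltonian_toFock (A : Finset Λ) (hA : ∀ x y : Λ, G.Adj x y → (x ∈ A ↔ y ∉ A))
    (t U : ℝ) (M : Matrix (Finset Λ) (Finset Λ) ℂ) :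
    star (toFock A M) ⬝ᵥ (hamiltonian G t U *ᵥ toFock A M) = hsInner M (liebOperator G t U M) := by
  rw [hamiltonian_mulVec_toFock G A hA, star_toFock_dotProduct_toFock]

/-- `⟨M, 𝓛 M⟩_HS = tr(MᴴKM) + tr(MᴴMK) - U Σ_x tr(Mᴴ n_x M n_x) + U Σ_x tr(Mᴴ n_x M)`
(`K = hoppingMatrix G t`, `n_x = numberAt x`). Lieb, PRL 62 (1989) 1201, eqs. (4)–(5). [cite: LiebPRL1989, eqs. (4)–(5)] -/
theorem hsInner_liebOperator (t U : ℝ) (M : Matrix (Finset Λ) (Finset Λ) ℂ) :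
    hsInner M (liebOperator G t U M) =
      (Mᴴ * hoppingMatrix G t * M).trace + (Mᴴ * M * hoppingMatrix G t).trace -
        (U : ℂ) * ∑ x : Λ, (Mᴴ * numberAt x * M * numberAt x).trace +
        (U : ℂ) * ∑ x : Λ, (Mᴴ * numberAt x * M).trace := by
  rw [liebOperator, Literature.MathematicalPhysics.QuantumLattice.liebOp, totalNumberOp, Finset.sum_mul,
    hsInner]
  simp only [Matrix.mul_add, Matrix.mul_smul, Matrix.mul_sum, trace_add, trace_smul, trace_sum,
    smul_eq_mul, Matrix.mul_assoc]
  push_cast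
  ring

/-- **The charge field in Lieb's coordinates.**
`⟨Φ(M), M_h Φ(M)⟩ = Σ_x h_x (tr(Mᴴ n_x M) - tr(Mᴴ M n_x))`. Kubo–Kishi, PRB 41 (1990) 4866,
proof of Thm 1. [folklore] -/
theorem expect_chargeField_toFock (A : Finset Λ) (h : Λ → ℝ) (M : Matrix (Finset Λ) (Finset Λ) ℂ) :
    star (toFock A M) ⬝ᵥ
        ((∑ x : Λ, ((h x : ℝ) : ℂ) • (numberOp x 0 + numberOp x 1 - 1)) *ᵥ toFock A M) =
      ∑ x : Λ, ((h x : ℝ) : ℂ) * ((Mᴴ * numberAt x * M).trace - (Mᴴ * M * numberAt x).trace) := by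
  rw [chargeField_mulVec_toFock, star_toFock_dotProduct_toFock, hsInner_sum_right]
  refine Finset.sum_congr rfl fun x _ => ?_
  rw [hsInner_smul_right, hsInner_sub_right, hsInner, hsInner, Matrix.mul_assoc, Matrix.mul_assoc]


end Expectations

section TraceAlgebra

variable {m : Type*} [Fintype m] [DecidableEq m]

/-- Expansion of `tr(X (n + a) Y (n + b))` for scalars `a`, `b`. [folklore] -/
theorem trace_mul_add_smul_one_expand (X Y n : Matrix m m ℂ) (a b : ℂ) :
    (X * (n + a • (1 : Matrix m m ℂ)) * Y * (n + b • (1 : Matrix m m ℂ))).trace =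
      (X * n * Y * n).trace + b * (X * n * Y).trace + a * (X * Y * n).trace + a * b * (X * Y).trace := by
  simp only [Matrix.mul_add, Matrix.add_mul, Matrix.mul_smul, Matrix.smul_mul, Matrix.mul_one,
    trace_add, trace_smul, smul_eq_mul]
  ring

omit [DecidableEq m] in
/-- `tr(c n c) = tr(Mᴴ n M)` and `tr(c c n) = tr(Mᴴ n M)` when `c² = M Mᴴ`. [folklore] -/
theorem trace_sq_left (c M n : Matrix m m ℂ) (hc : c * c = M * Mᴴ) :
    (c * n * c).trace = (Mᴴ * n * M).trace ∧ (c * c * n).trace = (Mᴴ * n * M).trace := by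
  have key : (M * Mᴴ * n).trace = (Mᴴ * n * M).trace := by
    rw [trace_mul_cycle M Mᴴ n, trace_mul_comm (n * M) Mᴴ, ← Matrix.mul_assoc]
  constructor
  · rw [trace_mul_comm (c * n) c, ← Matrix.mul_assoc, hc, key]
  · rw [hc, key]

omit [DecidableEq m] in
/-- `tr(c n c) = tr(Mᴴ M n)` and `tr(c c n) = tr(Mᴴ M n)` when `c² = Mᴴ M`. [folklore] -/
theorem trace_sq_right (c M n : Matrix m m ℂ) (hc : c * c = Mᴴ * M) :
    (c * n * c).trace = (Mᴴ * M * n).trace ∧ (c * c * n).trace = (Mᴴ * M * n).trace := by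
  constructor
  · rw [trace_mul_comm (c * n) c, ← Matrix.mul_assoc, hc]
  · rw [hc]


omit [Fintype m] in
/-- `(n + r·1)ᴴ = n + r·1` for Hermitian `n` and real `r`. [folklore] -/
theorem conjTranspose_add_real_smul_one {n : Matrix m m ℂ} (hn : nᴴ = n) (r : ℝ) :
    (n + ((r : ℝ) : ℂ) • (1 : Matrix m m ℂ))ᴴ = n + ((r : ℝ) : ℂ) • (1 : Matrix m m ℂ) := by
  rw [conjTranspose_add, conjTranspose_smul, conjTranspose_one, hn, Complex.star_def, Complex.conj_ofReal]

/-- **The Kennedy–Lieb–Shastry trace inequality tested against shifted occupations** (the single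
reflection step of Gaussian domination in spin space): if `(c, c_L, c_R)` is a KLS trace pair
(`Matrix.exists_kls_tracePair`) and `n` is Hermitian, then for every real `κ`,
`4κ (tr(cᴴ n c) - tr(cᴴ c n)) ≤ tr(c_L n c_L n) + tr(c_R n c_R n) - 2 tr(cᴴ n c n) + 4κ² tr(cᴴ c)`
(apply the pair inequality to `M = n - κ`, `N = n + κ`; the field disappears from the reflected
terms). Dyson–Lieb–Simon, J. Stat. Phys. 18 (1978) 335, Lemma 4.1 / Thm 4.2; Kubo–Kishi, PRB 41
(1990) 4866, eq. (9). [cite: KuboKishi1990, eq. (9)] -/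
theorem kls_shifted_occupation {c cL cR n : Matrix m m ℂ}
    (hineq : ∀ M N : Matrix m m ℂ, 2 * ((cᴴ * M * c * Nᴴ).trace).re ≤
      ((cL * M * cL * Mᴴ).trace).re + ((cR * N * cR * Nᴴ).trace).re)
    (hLsq : cL * cL = c * cᴴ) (hRsq : cR * cR = cᴴ * c) (hn : nᴴ = n) (κ : ℝ) :
    4 * κ * (((cᴴ * n * c).trace).re - ((cᴴ * c * n).trace).re) ≤
      ((cL * n * cL * n).trace).re + ((cR * n * cR * n).trace).re - 2 * ((cᴴ * n * c * n).trace).re +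
        4 * κ ^ 2 * ((cᴴ * c).trace).re := by
  have h := hineq (n + ((-κ : ℝ) : ℂ) • 1) (n + ((κ : ℝ) : ℂ) • 1)
  rw [conjTranspose_add_real_smul_one hn, conjTranspose_add_real_smul_one hn,
    trace_mul_add_smul_one_expand, trace_mul_add_smul_one_expand, trace_mul_add_smul_one_expand] at h
  obtain ⟨hL1, hL2⟩ := trace_sq_left cL c n hLsq
  obtain ⟨hR1, hR2⟩ := trace_sq_right cR c n hRsq
  have hLL : (cL * cL).trace = (cᴴ * c).trace := by rw [hLsq, trace_mul_comm]
  have hRR : (cR * cR).trace = (cᴴ * c).trace := by rw [hRsq]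
  rw [hL1, hL2, hR1, hR2, hLL, hRR] at h
  simp only [Complex.add_re, Complex.mul_re, Complex.mul_im, Complex.ofReal_re, Complex.ofReal_im,
    Complex.ofReal_neg, zero_mul, mul_zero, sub_zero, add_zero, Complex.neg_re, Complex.neg_im,
    neg_zero] at h
  nlinarith [h]


end TraceAlgebra

section GaussianDomination

variable {Λ : Type*} [LinearOrder Λ] [Fintype Λ] (G : SimpleGraph Λ) [DecidableRel G.Adj]

/-- **Gaussian domination in Lieb's coordinates, raw form.** For every coefficient matrix `M`,
real field `h` and `U > 0` there is a KLS trace pair `(c_L, c_R)` (`c_L² = MMᴴ`, `c_R² = MᴴM`,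
positive semidefinite) with
`Σ_x h_x (tr(Mᴴn_xM) - tr(MᴴMn_x)) ≤ (U/2) Σ_x (tr(c_Ln_xc_Ln_x) + tr(c_Rn_xc_Rn_x)) - U Σ_x tr(Mᴴn_xMn_x)
  + (Σ_x h_x²)/(2U) · tr(MᴴM)`.
Kubo–Kishi, PRB 41 (1990) 4866, eqs. (7)–(9) (at `T = 0`, via Kennedy–Lieb–Shastry's ground-state
reflection positivity). [cite: KuboKishi1990, eqs. (7)–(9)] -/
theorem gaussianDomination_raw {U : ℝ} (hU : 0 < U) (h : Λ → ℝ) (M : Matrix (Finset Λ) (Finset Λ) ℂ) :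
    ∃ cL cR : Matrix (Finset Λ) (Finset Λ) ℂ, cL.PosSemidef ∧ cR.PosSemidef ∧ cL * cL = M * Mᴴ ∧
      cR * cR = Mᴴ * M ∧
      (∑ x : Λ, h x * (((Mᴴ * numberAt x * M).trace).re - ((Mᴴ * M * numberAt x).trace).re)) ≤
        U / 2 * ∑ x : Λ, (((cL * numberAt x * cL * numberAt x).trace).re +
            ((cR * numberAt x * cR * numberAt x).trace).re) -
          U * ∑ x : Λ, ((Mᴴ * numberAt x * M * numberAt x).trace).re +
          (∑ x : Λ, h x ^ 2) / (2 * U) * ((Mᴴ * M).trace).re := by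
  obtain ⟨cL, cR, hL, hR, hLsq, hRsq, hineq⟩ := Matrix.exists_kls_tracePair M
  refine ⟨cL, cR, hL, hR, hLsq, hRsq, ?_⟩
  have hsite : ∀ x : Λ,
      h x * (((Mᴴ * numberAt x * M).trace).re - ((Mᴴ * M * numberAt x).trace).re) ≤
        U / 2 * (((cL * numberAt x * cL * numberAt x).trace).re +
            ((cR * numberAt x * cR * numberAt x).trace).re) -
          U * ((Mᴴ * numberAt x * M * numberAt x).trace).re +
          h x ^ 2 / (2 * U) * ((Mᴴ * M).trace).re := by
    intro x
    have hk := kls_shifted_occupation hineq hLsq hRsq (numberAt_isHermitian x).eq (h x / (2 * U))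
    have hτ : 0 ≤ ((Mᴴ * M).trace).re := by
      rw [← hsInner, hsInner_self_re]
      positivity
    have hU2 : (0 : ℝ) < 2 * U := by positivity
    -- multiply the KLS inequality by `U/2`
    have hk' := mul_le_mul_of_nonneg_left hk (le_of_lt (half_pos hU))
    have e1 : U / 2 * (4 * (h x / (2 * U)) *
        (((Mᴴ * numberAt x * M).trace).re - ((Mᴴ * M * numberAt x).trace).re)) =
        h x * (((Mᴴ * numberAt x * M).trace).re - ((Mᴴ * M * numberAt x).trace).re) := by
      field_simp
      ring
    have e2 : U / 2 * (4 * (h x / (2 * U)) ^ 2 * ((Mᴴ * M).trace).re) =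
        h x ^ 2 / (2 * U) * ((Mᴴ * M).trace).re := by
      field_simp
      ring
    rw [e1] at hk'
    calc h x * (((Mᴴ * numberAt x * M).trace).re - ((Mᴴ * M * numberAt x).trace).re)
        ≤ U / 2 * (((cL * numberAt x * cL * numberAt x).trace).re +
            ((cR * numberAt x * cR * numberAt x).trace).re -
            2 * ((Mᴴ * numberAt x * M * numberAt x).trace).re +
            4 * (h x / (2 * U)) ^ 2 * ((Mᴴ * M).trace).re) := hk'
      _ = _ := by rw [mul_add, mul_sub, e2]; ring
  have hsum := Finset.sum_le_sum fun x (_ : x ∈ (Finset.univ : Finset Λ)) => hsite x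
  rw [Finset.sum_add_distrib, Finset.sum_sub_distrib, ← Finset.mul_sum, ← Finset.mul_sum,
    ← Finset.sum_mul, ← Finset.sum_div] at hsum
  exact hsum

/-- **Gaussian domination in Lieb's coordinates, energy form.** With `E(X) = Re ⟨X, 𝓛 X⟩_HS`
(`= ⟨Φ(X), H Φ(X)⟩`), for every `M`, real field `h` and `U > 0` the KLS pair satisfies
`Σ_x h_x (tr(Mᴴn_xM) - tr(MᴴMn_x)) ≤ E(M) - ½(E(c_L) + E(c_R)) - (U/2) Σ_x (tr(Mᴴn_xM) - tr(MᴴMn_x))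
  + (Σ_x h_x²)/(2U) · tr(MᴴM)`:
the field costs at most `Σh²/(2U)` beyond the energy excess of `M` over the two reflected states.
Kubo–Kishi, PRB 41 (1990) 4866, Thm 1 / eq. (10) at `T = 0`. [cite: KuboKishi1990, Theorem 1] -/
theorem gaussianDomination_energy (t : ℝ) {U : ℝ} (hU : 0 < U) (h : Λ → ℝ)
    (M : Matrix (Finset Λ) (Finset Λ) ℂ) :
    ∃ cL cR : Matrix (Finset Λ) (Finset Λ) ℂ, cL.PosSemidef ∧ cR.PosSemidef ∧ cL * cL = M * Mᴴ ∧
      cR * cR = Mᴴ * M ∧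
      (∑ x : Λ, h x * (((Mᴴ * numberAt x * M).trace).re - ((Mᴴ * M * numberAt x).trace).re)) ≤
        (hsInner M (liebOperator G t U M)).re -
          ((hsInner cL (liebOperator G t U cL)).re + (hsInner cR (liebOperator G t U cR)).re) / 2 -
          U / 2 * (∑ x : Λ, (((Mᴴ * numberAt x * M).trace).re - ((Mᴴ * M * numberAt x).trace).re)) +
          (∑ x : Λ, h x ^ 2) / (2 * U) * ((Mᴴ * M).trace).re := by
  obtain ⟨cL, cR, hL, hR, hLsq, hRsq, hraw⟩ := gaussianDomination_raw (Λ := Λ) hU h M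
  refine ⟨cL, cR, hL, hR, hLsq, hRsq, ?_⟩
  -- the three energies in trace form
  have hEM := hsInner_liebOperator G t U M
  have hEL := hsInner_liebOperator G t U cL
  have hER := hsInner_liebOperator G t U cR
  rw [hL.1.eq] at hEL
  rw [hR.1.eq] at hER
  obtain ⟨hL1, hL2⟩ := trace_sq_left cL M (hoppingMatrix G t) hLsq
  obtain ⟨hR1, hR2⟩ := trace_sq_right cR M (hoppingMatrix G t) hRsq
  have hLn : ∀ x : Λ, (cL * numberAt x * cL).trace = (Mᴴ * numberAt x * M).trace :=
    fun x => (trace_sq_left cL M (numberAt x) hLsq).1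
  have hRn : ∀ x : Λ, (cR * numberAt x * cR).trace = (Mᴴ * M * numberAt x).trace :=
    fun x => (trace_sq_right cR M (numberAt x) hRsq).1
  rw [hL1, hL2] at hEL
  rw [hR1, hR2] at hER
  simp only [hLn] at hEL
  simp only [hRn] at hER
  rw [hEM, hEL, hER]
  simp only [Complex.add_re, Complex.sub_re, Complex.re_sum, Complex.re_ofReal_mul]
  have : ∑ x : Λ, ((Mᴴ * numberAt x * M).trace.re - (Mᴴ * M * numberAt x).trace.re) =
      ∑ x : Λ, (Mᴴ * numberAt x * M).trace.re - ∑ x : Λ, (Mᴴ * M * numberAt x).trace.re :=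
    Finset.sum_sub_distrib _ _
  rw [this]
  have h2 : ∑ x : Λ, ((cL * numberAt x * cL * numberAt x).trace.re +
      (cR * numberAt x * cR * numberAt x).trace.re) =
      ∑ x : Λ, (cL * numberAt x * cL * numberAt x).trace.re +
        ∑ x : Λ, (cR * numberAt x * cR * numberAt x).trace.re := Finset.sum_add_distrib
  rw [h2] at hraw
  linarith


end GaussianDomination

/-! ### The Hubbard torus -/

section Torus

/-- **Registered stub `stub_halfFillingGDLiebCoordinates`** of crux `NoOnsiteODLRO`
(stmt-HubbardSuperconductivity-0933; by-product — engine of the `δ = 0` endpoint, not a piece of a line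
composition): **Gaussian domination for the Hubbard torus in Lieb's coordinates.** For `U > 0`, every
coefficient matrix `M` on the torus `(ℤ/Lℤ)²` and every real field `h` there is a KLS trace pair
`(c_L, c_R)` (positive semidefinite, `c_L² = MMᴴ`, `c_R² = MᴴM`) with
`Σ_x h_x (tr(Mᴴn_xM) - tr(MᴴMn_x)) ≤ E(M) - ½(E(c_L) + E(c_R)) - (U/2) Σ_x (tr(Mᴴn_xM) - tr(MᴴMn_x))
  + (Σ_x h_x²/(2U)) tr(MᴴM)`, `E(X) = Re ⟨X, 𝓛 X⟩_HS` for `𝓛 = LiebTwo.liebOperator (fermionTorusGraph 2 L) 1 U`.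
Kubo–Kishi, PRB 41 (1990) 4866, Thm 1 / eq. (9); Kennedy–Lieb–Shastry, J. Stat. Phys. 53 (1988) 1019,
eqs. (20)–(25). [cite: KuboKishi1990, Theorem 1] -/
theorem stub_halfFillingGDLiebCoordinates : open Literature.MathematicalPhysics.QuantumLattice in ∀ (U : ℝ), 0 < U → ∀ (L : ℕ) [NeZero L] (h : FermionTorus 2 L → ℝ) (M : Matrix (Finset (FermionTorus 2 L)) (Finset (FermionTorus 2 L)) ℂ), ∃ cL cR : Matrix (Finset (FermionTorus 2 L)) (Finset (FermionTorus 2 L)) ℂ, cL.PosSemidef ∧ cR.PosSemidef ∧ cL * cL = M * Mᴴ ∧ cR * cR = Mᴴ * M ∧ (∑ x : FermionTorus 2 L, h x * (((Mᴴ * numberAt x * M).trace).re - ((Mᴴ * M * numberAt x).trace).re)) ≤ (hsInner M (LiebTwo.liebOperator (fermionTorusGraph 2 L) 1 U M)).re - ((hsInner cL (LiebTwo.liebOperator (fermionTorusGraph 2 L) 1 U cL)).re + (hsInner cR (LiebTwo.liebOperator (fermionTorusGraph 2 L) 1 U cR)).re) / 2 - U / 2 * (∑ x : FermionTorus 2 L,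 (((Mᴴ * numberAt x * M).trace).re - ((Mᴴ * M * numberAt x).trace).re)) + (∑ x : FermionTorus 2 L, h x ^ 2) / (2 * U) * ((Mᴴ * M).trace).re :=
  fun _U hU L _ h M => gaussianDomination_energy (fermionTorusGraph 2 L) 1 hU h M

end Torus

end Summit.HubbardSuperconductivity.HubbardSuperconductivity.Theorems.NoOnsiteODLRO.HalfFilling
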